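import Mathlib.Analysis.Fourier.Inversion
import Mathlib.MeasureTheory.Measure.LevyConvergence
import Mathlib.MeasureTheory.Measure.Prokhorov
import Mathlib.MeasureTheory.Measure.LevyProkhorovMetric
import Mathlib.MeasureTheory.Function.SimpleFuncDense
import Mathlib.MeasureTheory.Group.Prod
import Mathlib.MeasureTheory.Group.Integral
import Literature.Analysis.FunctionSpaces.NuclearSpace
import HarnessLib

/-!
# Bochner's theorem: proofs

This file discharges the named facts of `Literature/Analysis/FunctionSpaces/NuclearSpace.lean`
concerning positive-definite functions and **Bochner's theorem** on a finite-dimensional real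
inner product space `V`:

* `Literature.Analysis.FunctionSpaces.IsPositiveDefinite.conj_neg_holds`, `Literature.Analysis.FunctionSpaces.IsPositiveDefinite.norm_apply_le_holds`
  (Hermitian symmetry and boundedness of positive-definite functions);
* `Literature.Analysis.FunctionSpaces.IsPositiveDefinite.exists_charFun_eq_holds` (Bochner, existence: a continuous
  positive-definite `C` with `C 0 = 1` is `charFun μ` for a probability measure `μ`);
* `Literature.Analysis.FunctionSpaces.bochner_holds` (existence and uniqueness).

## Proof (Bochner 1933, §§2–3, Satz 22; Bochner–Chandrasekharan 1949 for `ℝⁿ`)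

The classical Gaussian-regularisation proof, organised around Mathlib's Fourier analysis:

1. *Integrated positive definiteness* (`IsPositiveDefinite.re_integral_integral_nonneg`):
   `∫∫ conj (h s) h(t) C(t - s) dρ dρ ≥ 0` for a finite measure `ρ` and bounded continuous
   `h`, by approximating the identity by simple functions (`SimpleFunc.approxOn`), which turns
   the double integral into positive-definite double sums, and dominated convergence.
2. *Positivity* (`IsPositiveDefinite.re_fourier_gauss_mul_nonneg`): for `σ > 0` the Fourier
   transform of `F_σ = exp (-σ‖·‖²/2) · C` is a nonnegative real function, since the Gaussian
   is an autocorrelation `exp (-σ‖v‖²/2) = κ⁻¹ ∫ exp (-σ‖s‖²) exp (-σ‖v+s‖²) ds`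
   (`integral_gaussWeight_mul_gaussWeight_add`, from Mathlib's Gaussian integrals), so that
   `κ 𝓕F_σ(w)` is a double integral as in 1 (Fubini and translation invariance).
3. *Integrability* (`IsPositiveDefinite.integrable_fourier_gaussMul`): testing `𝓕 F_σ ≥ 0`
   against the Gaussians `exp (-c⁻¹‖w‖²) ↑ 1` and using the self-adjointness of the Fourier
   transform (Mathlib `VectorFourier.integral_fourierIntegral_smul_eq_flip`) and the explicit
   heat kernel (`fourier_gaussian_innerProductSpace`) gives `∫ exp (-c⁻¹‖w‖²) 𝓕F_σ ≤ 1`, hence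
   `∫ 𝓕 F_σ ≤ 1` by monotone convergence.
4. *The approximating measures* (`IsPositiveDefinite.exists_measure_charFun_gaussMul`): by
   Fourier inversion (Mathlib `Continuous.fourierInv_fourier_eq`) the probability measure with
   density `𝓕 F_σ` (rescaled by `2π`) has characteristic function `F_σ`.
5. *The limit* (`exists_charFun_eq_holds`): as `σ = 1/(n+1) → 0`, `F_σ → C` pointwise with `C`
   continuous at `0`, so the measures are tight (Mathlib `isTightMeasureSet_of_tendsto_charFun`,
   Lévy), a subsequence converges weakly by Prokhorov's theorem (Mathlib
   `isCompact_closure_of_isTightMeasureSet`), and the limit has characteristic function `C`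
   (Mathlib `ProbabilityMeasure.tendsto_iff_tendsto_charFun`).

## References

* S. Bochner, *Monotone Funktionen, Stieltjessche Integrale und harmonische Analyse*, Math. Ann.
  108 (1933), 378–410, §§1–3, Satz 22.
* S. Bochner, K. Chandrasekharan, *Fourier Transforms*, Annals of Math. Studies 19 (1949),
  Ch. II §8 (Bochner's theorem in `ℝⁿ`).
-/

open scoped ComplexConjugate NNReal ENNReal RealInnerProductSpace FourierTransform Topology
open MeasureTheory Filter Complex Real

namespace Literature.Analysis.FunctionSpaces

/-! ### Elementary consequences of positive definiteness -/

section PDBasics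

variable {G : Type*} [AddGroup G] {C : G → ℂ}

/-- Hermitian symmetry of a positive-definite function, `C (-x) = conj (C x)` (discharge of the
named fact `IsPositiveDefinite.conj_neg`): the imaginary parts of the `2 × 2` forms with
coefficient vectors `(1, 1)` and `(1, i)` vanish. Bochner 1933 §1; Gel'fand–Vilenkin IV,
Ch. II §3.1. [cite: Bochner1933, §1] -/
theorem IsPositiveDefinite.conj_neg_holds : IsPositiveDefinite.conj_neg (C := C) := by
  intro hC x
  have h0 := hC.apply_zero_im
  have h1 := (hC 2 ![0, x] ![1, 1]).2
  have h2 := (hC 2 ![0, x] ![1, I]).2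
  simp [Fin.sum_univ_two] at h1 h2
  apply Complex.ext
  · simp
    linarith
  · simp
    linarith

/-- A positive-definite function is bounded by its value at `0`, `‖C x‖ ≤ re (C 0)` (discharge
of the named fact `IsPositiveDefinite.norm_apply_le`): the `2 × 2` form with coefficient
vector `(1, -conj (C x) / ‖C x‖)`. Bochner 1933 §1; Gel'fand–Vilenkin IV, Ch. II §3.1.
[cite: Bochner1933, §1] -/
theorem IsPositiveDefinite.norm_apply_le_holds : IsPositiveDefinite.norm_apply_le (C := C) := by
  intro hC x
  have h0re := hC.apply_zero_re_nonneg
  have h0im := hC.apply_zero_im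
  by_cases hx : C x = 0
  · rw [hx, norm_zero]
    exact h0re
  have hn : 0 < ‖C x‖ := norm_pos_iff.2 hx
  have hneg : C (-x) = conj (C x) := IsPositiveDefinite.conj_neg_holds hC x
  set lam : ℂ := -(conj (C x)) / (‖C x‖ : ℂ) with hlam
  have hnC : (‖C x‖ : ℂ) ≠ 0 := by exact_mod_cast hn.ne'
  have hlamCx : lam * C x = -(‖C x‖ : ℂ) := by
    rw [hlam, div_mul_eq_mul_div, neg_mul, Complex.conj_mul' (C x), neg_div, sq, mul_div_assoc,
      div_self hnC, mul_one]
  have hlamlam : conj lam * lam = 1 := by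
    rw [hlam]
    simp only [map_neg, map_div₀, Complex.conj_conj, Complex.conj_ofReal]
    rw [div_mul_div_comm, neg_mul_neg, Complex.mul_conj', ← pow_two]
    exact div_self (pow_ne_zero 2 hnC)
  have hconj : conj lam * conj (C x) = -(‖C x‖ : ℂ) := by
    rw [← map_mul, hlamCx, map_neg, Complex.conj_ofReal]
  have h1 := (hC 2 ![0, x] ![1, lam]).1
  simp only [Fin.sum_univ_two, Matrix.cons_val_zero, Matrix.cons_val_one, map_one, one_mul,
    mul_one, sub_zero, zero_sub, sub_self, neg_zero, hneg, hlamCx, hconj, hlamlam] at h1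
  simp only [Complex.add_re, Complex.neg_re, Complex.ofReal_re] at h1
  linarith

/-- Positive definiteness for families indexed by an arbitrary finite type (reindexing along
`Fintype.equivFin`). [folklore] -/
theorem IsPositiveDefinite.sum_sum_nonneg (hC : IsPositiveDefinite C) {ι : Type*} [Fintype ι]
    (x : ι → G) (c : ι → ℂ) :
    0 ≤ (∑ i, ∑ j, conj (c i) * c j * C (x j - x i)).re ∧
      (∑ i, ∑ j, conj (c i) * c j * C (x j - x i)).im = 0 := by
  classical
  set e := Fintype.equivFin ι with he
  have h := hC (Fintype.card ι) (x ∘ e.symm) (c ∘ e.symm)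
  have hsum : (∑ i : Fin (Fintype.card ι), ∑ j : Fin (Fintype.card ι),
      conj ((c ∘ e.symm) i) * (c ∘ e.symm) j * C ((x ∘ e.symm) j - (x ∘ e.symm) i)) =
      ∑ i, ∑ j, conj (c i) * c j * C (x j - x i) := by
    simp only [Function.comp]
    rw [e.symm.sum_comp (fun i => ∑ j : Fin (Fintype.card ι),
      conj (c i) * c (e.symm j) * C (x (e.symm j) - x i))]
    refine Finset.sum_congr rfl fun i _ => ?_
    exact e.symm.sum_comp (fun j => conj (c i) * c j * C (x j - x i))
  rw [hsum] at h
  exact h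

/-- Positive definiteness for families indexed by a `Finset`. [folklore] -/
theorem IsPositiveDefinite.finset_sum_sum_nonneg (hC : IsPositiveDefinite C) {ι : Type*}
    (s : Finset ι) (x : ι → G) (c : ι → ℂ) :
    0 ≤ (∑ i ∈ s, ∑ j ∈ s, conj (c i) * c j * C (x j - x i)).re ∧
      (∑ i ∈ s, ∑ j ∈ s, conj (c i) * c j * C (x j - x i)).im = 0 := by
  have h := hC.sum_sum_nonneg (fun i : s => x i) (fun i : s => c i)
  have e1 : (∑ i : s, ∑ j : s, conj (c i) * c j * C (x j - x i)) =
      ∑ i ∈ s, ∑ j ∈ s, conj (c i) * c j * C (x j - x i) := by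
    conv_rhs => rw [← Finset.sum_coe_sort]
    refine Finset.sum_congr rfl fun i _ => ?_
    exact Finset.sum_coe_sort s (fun j => conj (c i) * c j * C (x j - x i))
  rw [e1] at h
  exact h

end PDBasics

/-! ### Integrated positive definiteness -/

section IntegratedPD

/-- The integral of `g ∘ φ` for a simple function `φ` against a finite measure is the finite sum
`∑_b ρ(φ = b) g(b)`. [folklore] -/
theorem integral_comp_simpleFunc {X Y : Type*} [MeasurableSpace X] (ρ : Measure X)
    [IsFiniteMeasure ρ] (φ : SimpleFunc X Y) (g : Y → ℂ) :
    ∫ t, g (φ t) ∂ρ = ∑ b ∈ φ.range, (ρ.real (φ ⁻¹' {b}) : ℂ) * g b := by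
  have hpt : ∀ t, g (φ t) = ∑ b ∈ φ.range, (φ ⁻¹' {b}).indicator (fun _ => g b) t := by
    intro t
    rw [Finset.sum_eq_single (φ t)]
    · rw [Set.indicator_of_mem]
      exact rfl
    · intro b _ hb
      rw [Set.indicator_of_notMem]
      rw [Set.mem_preimage, Set.mem_singleton_iff]
      exact Ne.symm hb
    · intro h
      exact absurd (φ.mem_range_self t) h
  simp_rw [hpt]
  rw [integral_finsetSum _ (fun b _ =>
    (integrable_const (g b)).indicator (φ.measurableSet_fiber b))]
  refine Finset.sum_congr rfl fun b _ => ?_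
  rw [integral_indicator_const _ (φ.measurableSet_fiber b), Complex.real_smul]

variable {V : Type*} [NormedAddCommGroup V] [MeasurableSpace V] [BorelSpace V]
  [SecondCountableTopology V]

/-- **Integrated positive definiteness.** For a continuous positive-definite `C` with `‖C‖ ≤ 1`,
a finite measure `ρ` and a continuous `h` with `‖h‖ ≤ 1`, the double integral
`∫∫ conj (h s) h(t) C(t - s) dρ(s) dρ(t)` is a nonnegative real number: replacing `s, t` by
simple approximations `φₖ s, φₖ t` (Mathlib `SimpleFunc.approxOn`) turns it into a finite
positive-definite double sum with coefficients `ρ(φₖ = a) h(a)`, and dominated convergence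
passes to the limit. This is the standard passage from the discrete to the integral form of
positive definiteness (Bochner 1933, §2). [cite: Bochner1933, §2] -/
theorem IsPositiveDefinite.re_integral_integral_nonneg {C : V → ℂ} (hC : IsPositiveDefinite C)
    (hCc : Continuous C) (hCb : ∀ x, ‖C x‖ ≤ 1) (ρ : Measure V) [IsFiniteMeasure ρ]
    {h : V → ℂ} (hh : Continuous h) (hhb : ∀ x, ‖h x‖ ≤ 1) :
    0 ≤ (∫ s, ∫ t, conj (h s) * h t * C (t - s) ∂ρ ∂ρ).re ∧
      (∫ s, ∫ t, conj (h s) * h t * C (t - s) ∂ρ ∂ρ).im = 0 := by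
  obtain ⟨Ψ, hΨ⟩ : ∃ Ψ : V → V → ℂ, ∀ a b, Ψ a b = conj (h a) * h b * C (b - a) :=
    ⟨_, fun _ _ => rfl⟩
  have hΨb : ∀ a b, ‖Ψ a b‖ ≤ 1 := fun a b => by
    rw [hΨ, norm_mul, norm_mul, Complex.norm_conj]
    exact mul_le_one₀ (mul_le_one₀ (hhb a) (norm_nonneg _) (hhb b)) (norm_nonneg _) (hCb _)
  have hΨc : Continuous fun p : V × V => Ψ p.1 p.2 := by
    simp only [hΨ]
    fun_prop
  -- simple approximations of the identity
  obtain ⟨φ, hφt⟩ : ∃ φ : ℕ → SimpleFunc V V, ∀ x, Tendsto (fun k => φ k x) atTop (𝓝 x) :=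
    ⟨fun k => SimpleFunc.approxOn id measurable_id Set.univ 0 (Set.mem_univ 0) k, fun x =>
      SimpleFunc.tendsto_approxOn measurable_id (Set.mem_univ 0) (by simp)⟩
  set I : ℕ → ℂ := fun k => ∫ s, ∫ t, Ψ (φ k s) (φ k t) ∂ρ ∂ρ with hI
  -- each `I k` is a positive-definite double sum
  have hIk : ∀ k, 0 ≤ (I k).re ∧ (I k).im = 0 := by
    intro k
    set R := (φ k).range with hR
    set wgt : V → ℝ := fun b => ρ.real ((φ k) ⁻¹' {b}) with hwgt
    have hinner : ∀ a, ∫ t, Ψ a (φ k t) ∂ρ = ∑ b ∈ R, (wgt b : ℂ) * Ψ a b := fun a =>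
      integral_comp_simpleFunc ρ (φ k) (Ψ a)
    have hI' : I k = ∑ a ∈ R, ∑ b ∈ R,
        conj ((wgt a : ℂ) * h a) * ((wgt b : ℂ) * h b) * C (b - a) := by
      simp only [hI]
      simp_rw [hinner]
      rw [integral_comp_simpleFunc ρ (φ k) (fun a => ∑ b ∈ R, (wgt b : ℂ) * Ψ a b)]
      refine Finset.sum_congr rfl fun a _ => ?_
      rw [Finset.mul_sum]
      refine Finset.sum_congr rfl fun b _ => ?_
      simp only [hΨ, map_mul, Complex.conj_ofReal]
      ring
    rw [hI']
    exact hC.finset_sum_sum_nonneg R id (fun a => (wgt a : ℂ) * h a)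
  -- dominated convergence, twice
  have hIlim : Tendsto I atTop (𝓝 (∫ s, ∫ t, Ψ s t ∂ρ ∂ρ)) := by
    refine tendsto_integral_of_dominated_convergence (fun _ => 1 * ρ.real Set.univ)
      (fun k => ?_) (integrable_const _) (fun k => ae_of_all _ fun s => ?_)
      (ae_of_all _ fun s => ?_)
    · exact ((φ k).map fun a => ∫ t, Ψ a (φ k t) ∂ρ).aestronglyMeasurable
    · exact norm_integral_le_of_norm_le_const (ae_of_all _ fun t => hΨb _ _)
    · refine tendsto_integral_of_dominated_convergence (fun _ => (1 : ℝ)) (fun k => ?_)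
        (integrable_const _) (fun k => ae_of_all _ fun t => hΨb _ _) (ae_of_all _ fun t => ?_)
      · have hc : Continuous fun b => Ψ (φ k s) b :=
          hΨc.comp (continuous_const.prodMk continuous_id)
        exact (hc.measurable.comp (φ k).measurable).aestronglyMeasurable
      · exact (hΨc.tendsto (s, t)).comp ((hφt s).prodMk_nhds (hφt t))
  have hre : Tendsto (fun k => (I k).re) atTop (𝓝 (∫ s, ∫ t, Ψ s t ∂ρ ∂ρ).re) :=
    (Complex.continuous_re.tendsto _).comp hIlim
  have him : Tendsto (fun k => (I k).im) atTop (𝓝 (∫ s, ∫ t, Ψ s t ∂ρ ∂ρ).im) :=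
    (Complex.continuous_im.tendsto _).comp hIlim
  have him0 : Tendsto (fun k => (I k).im) atTop (𝓝 0) := by
    have : (fun k => (I k).im) = fun _ => 0 := funext fun k => (hIk k).2
    rw [this]
    exact tendsto_const_nhds
  simp only [hΨ] at hre him
  exact ⟨ge_of_tendsto' hre fun k => (hIk k).1, tendsto_nhds_unique him him0⟩

end IntegratedPD

/-! ### Gaussian integrals -/

section Gaussian

variable {V : Type*} [NormedAddCommGroup V] [InnerProductSpace ℝ V] [FiniteDimensional ℝ V]
  [MeasurableSpace V] [BorelSpace V]

/-- The Gaussian weight `s ↦ exp (-σ ‖s‖²)` is integrable for `σ > 0`. [folklore] -/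
theorem integrable_rexp_neg_mul_sq_norm {σ : ℝ} (hσ : 0 < σ) :
    Integrable (fun s : V => rexp (-σ * ‖s‖ ^ 2)) := by
  have h := (GaussianFourier.integrable_cexp_neg_mul_sq_norm_add (V := V) (b := (σ : ℂ))
    (by simpa using hσ) 0 0).norm
  refine h.congr (ae_of_all _ fun s => ?_)
  have h1 : (-(σ : ℂ) * (‖s‖ : ℂ) ^ 2 + 0 * (⟪(0 : V), s⟫ : ℂ)) = ((-σ * ‖s‖ ^ 2 : ℝ) : ℂ) := by
    push_cast
    ring
  simp only [h1, Complex.norm_exp, Complex.ofReal_re]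

/-- Gaussian integral with a linear term, real form:
`∫ exp (-b ‖v‖² + c ⟪w, v⟫) dv = (π / b)^{d/2} exp (c² ‖w‖² / (4 b))` (Mathlib
`GaussianFourier.integral_cexp_neg_mul_sq_norm_add`). [folklore] -/
theorem integral_rexp_neg_mul_sq_norm_add {b : ℝ} (hb : 0 < b) (c : ℝ) (w : V) :
    ∫ v : V, rexp (-b * ‖v‖ ^ 2 + c * ⟪w, v⟫) =
      (π / b) ^ (Module.finrank ℝ V / 2 : ℝ) * rexp (c ^ 2 * ‖w‖ ^ 2 / (4 * b)) := by
  rw [← Complex.ofReal_inj]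
  convert! GaussianFourier.integral_cexp_neg_mul_sq_norm_add (show 0 < (b : ℂ).re from hb)
    (c : ℂ) w using 1
  · rw [← integral_complex_ofReal]
    refine integral_congr_ae (ae_of_all _ fun v => ?_)
    push_cast
    ring_nf
  · rw [Complex.ofReal_mul, ← Complex.ofReal_div, Complex.ofReal_cpow (by positivity)]
    push_cast
    ring_nf

/-- The Gaussian autocorrelation identity
`∫ exp (-σ ‖s‖²) exp (-σ ‖v + s‖²) ds = (π / (2σ))^{d/2} exp (-σ ‖v‖² / 2)`. [folklore] -/
theorem integral_gaussWeight_mul_gaussWeight_add {σ : ℝ} (hσ : 0 < σ) (v : V) :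
    ∫ s : V, rexp (-σ * ‖s‖ ^ 2) * rexp (-σ * ‖v + s‖ ^ 2) =
      (π / (2 * σ)) ^ (Module.finrank ℝ V / 2 : ℝ) * rexp (-(σ / 2) * ‖v‖ ^ 2) := by
  have hpt : ∀ s : V, rexp (-σ * ‖s‖ ^ 2) * rexp (-σ * ‖v + s‖ ^ 2) =
      rexp (-σ * ‖v‖ ^ 2) * rexp (-(2 * σ) * ‖s‖ ^ 2 + (-(2 * σ)) * ⟪v, s⟫) := by
    intro s
    rw [← Real.exp_add, ← Real.exp_add, norm_add_sq_real]
    ring_nf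
  simp_rw [hpt]
  rw [integral_const_mul, integral_rexp_neg_mul_sq_norm_add (by positivity) _ v, mul_left_comm,
    ← Real.exp_add]
  congr 1
  congr 1
  field_simp
  ring

end Gaussian

/-! ### Positivity of the Fourier transform of `C · exp (-σ‖·‖²/2)` -/

section Positivity

variable {V : Type*} [NormedAddCommGroup V] [InnerProductSpace ℝ V] [FiniteDimensional ℝ V]
  [MeasurableSpace V] [BorelSpace V]

/-- **The Fourier transform of a Gaussian-damped positive-definite function is nonnegative.**
For `C` continuous positive definite with `‖C‖ ≤ 1` and `σ > 0`, the Fourier transform of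
`F_σ = exp (-σ‖·‖²/2) · C` is a nonnegative real function. Writing the Gaussian as an
autocorrelation, `exp (-σ‖v‖²/2) = κ⁻¹ ∫ exp (-σ‖s‖²) exp (-σ‖v + s‖²) ds`, gives
`κ · 𝓕 F_σ (w) = ∫∫ conj (e s) e(t) C(t - s) dρ(s) dρ(t)` with `e = 𝐞(-⟪·, w⟫)` and
`dρ = exp (-σ‖s‖²) ds`, which is nonnegative by integrated positive definiteness. Bochner 1933,
§§2–3 (Satz 22 for `ℝ`; `ℝⁿ` in Bochner–Chandrasekharan 1949). [cite: Bochner1933, §3] -/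
theorem IsPositiveDefinite.re_fourier_gauss_mul_nonneg {C : V → ℂ} (hC : IsPositiveDefinite C)
    (hCc : Continuous C) (hCb : ∀ x, ‖C x‖ ≤ 1) {σ : ℝ} (hσ : 0 < σ) (w : V) :
    0 ≤ (𝓕 (fun v : V => (rexp (-(σ / 2) * ‖v‖ ^ 2) : ℂ) * C v) w).re ∧
      (𝓕 (fun v : V => (rexp (-(σ / 2) * ‖v‖ ^ 2) : ℂ) * C v) w).im = 0 := by
  -- the weight and the weighted Lebesgue measure
  set ω : V → ℝ := fun s => rexp (-σ * ‖s‖ ^ 2) with hω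
  have hω0 : ∀ s, 0 < ω s := fun s => Real.exp_pos _
  have hωc : Continuous ω := by
    simp only [hω]
    fun_prop
  have hωi : Integrable ω := integrable_rexp_neg_mul_sq_norm hσ
  have hωm : Measurable fun s => (ω s).toNNReal := hωc.measurable.real_toNNReal
  set ρ : Measure V := volume.withDensity (fun s => ((ω s).toNNReal : ℝ≥0∞)) with hρ
  haveI : IsFiniteMeasure ρ := by
    refine isFiniteMeasure_withDensity (ne_of_lt (lt_of_le_of_lt (lintegral_mono fun s => ?_)
      hωi.hasFiniteIntegral))
    rw [Real.enorm_eq_ofReal (hω0 s).le]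
    exact le_of_eq rfl
  have hρint : ∀ g : V → ℂ, ∫ t, g t ∂ρ = ∫ t, (ω t : ℂ) * g t := by
    intro g
    rw [hρ, integral_withDensity_eq_integral_smul hωm]
    refine integral_congr_ae (ae_of_all _ fun t => ?_)
    dsimp only
    rw [NNReal.smul_def, Real.coe_toNNReal _ (hω0 t).le, Complex.real_smul]
  -- the character
  set e : V → ℂ := fun t => (𝐞 (-⟪t, w⟫) : ℂ) with he
  have hec : Continuous e := by
    simp only [he]
    fun_prop
  have heb : ∀ t, ‖e t‖ ≤ 1 := fun t => by simp [he]
  have hekey : ∀ s v, conj (e s) * e (v + s) = e v := by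
    intro s v
    simp only [he]
    rw [← Circle.coe_inv_eq_conj, ← AddChar.map_neg_eq_inv, neg_neg, ← Circle.coe_mul,
      ← AddChar.map_add_eq_mul, inner_add_left]
    congr 2
    ring
  -- Step 1: integrated positive definiteness
  have hPD := hC.re_integral_integral_nonneg hCc hCb ρ hec heb
  -- Step 2: the double integral is `κ · 𝓕 F_σ (w)`
  set κ : ℝ := (π / (2 * σ)) ^ (Module.finrank ℝ V / 2 : ℝ) with hκ
  have hκ0 : 0 < κ := by positivity
  have hint : Integrable (Function.uncurry fun s v : V =>
      (ω s : ℂ) * ((ω (v + s) : ℂ) * (e v * C v))) (volume.prod volume) := by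
    have h1 : Integrable (fun p : V × V => ω p.1 * ω p.2) (volume.prod volume) := hωi.mul_prod hωi
    have h2 := (measurePreserving_prod_add (volume : Measure V) (volume : Measure V))
      |>.integrable_comp_of_integrable h1
    have hJ : Integrable (fun p : V × V => ω p.1 * ω (p.2 + p.1)) (volume.prod volume) := by
      refine h2.congr (ae_of_all _ fun p => ?_)
      simp [Function.comp, add_comm]
    refine hJ.mono' ?_ (ae_of_all _ fun p => ?_)
    · refine Continuous.aestronglyMeasurable ?_
      simp only [Function.uncurry_def]
      fun_prop
    · rcases p with ⟨s, v⟩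
      simp only [Function.uncurry_apply_pair, norm_mul, Complex.norm_real, Real.norm_eq_abs,
        abs_of_pos (hω0 _)]
      have h3 : ‖e v‖ * ‖C v‖ ≤ 1 := mul_le_one₀ (heb v) (norm_nonneg _) (hCb v)
      calc ω s * (ω (v + s) * (‖e v‖ * ‖C v‖)) ≤ ω s * (ω (v + s) * 1) :=
            mul_le_mul_of_nonneg_left (mul_le_mul_of_nonneg_left h3 (hω0 _).le) (hω0 _).le
        _ = ω s * ω (v + s) := by ring
  have hD : ∫ s, ∫ t, conj (e s) * e t * C (t - s) ∂ρ ∂ρ =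
      (κ : ℂ) * 𝓕 (fun v : V => (rexp (-(σ / 2) * ‖v‖ ^ 2) : ℂ) * C v) w := by
    have hinner : ∀ s, ∫ t, conj (e s) * e t * C (t - s) ∂ρ =
        ∫ v, (ω (v + s) : ℂ) * (e v * C v) := by
      intro s
      rw [hρint, ← integral_add_right_eq_self (μ := volume)
        (fun t => (ω t : ℂ) * (conj (e s) * e t * C (t - s))) s]
      refine integral_congr_ae (ae_of_all _ fun v => ?_)
      simp only [add_sub_cancel_right]
      rw [← hekey s v]
    simp_rw [hinner]
    rw [hρint]
    simp_rw [← integral_const_mul]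
    rw [integral_integral_swap hint]
    have hin2 : ∀ v, ∫ s, (ω s : ℂ) * ((ω (v + s) : ℂ) * (e v * C v)) =
        ((κ * rexp (-(σ / 2) * ‖v‖ ^ 2) : ℝ) : ℂ) * (e v * C v) := by
      intro v
      rw [hκ, ← integral_gaussWeight_mul_gaussWeight_add hσ v, ← integral_complex_ofReal,
        ← integral_mul_const]
      refine integral_congr_ae (ae_of_all _ fun s => ?_)
      simp only [hω]
      push_cast
      ring
    have hF : ∀ v : V, ((κ * rexp (-(σ / 2) * ‖v‖ ^ 2) : ℝ) : ℂ) * (e v * C v) =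
        (κ : ℂ) * ((𝐞 (-⟪v, w⟫) : ℂ) * ((rexp (-(σ / 2) * ‖v‖ ^ 2) : ℂ) * C v)) := by
      intro v
      simp only [he]
      push_cast
      ring
    simp_rw [hin2, hF]
    rw [integral_const_mul, fourier_eq]
    simp_rw [Circle.smul_def, smul_eq_mul]
  rw [hD, Complex.re_ofReal_mul, Complex.im_ofReal_mul] at hPD
  exact ⟨(mul_nonneg_iff_of_pos_left hκ0).1 hPD.1, (mul_eq_zero.1 hPD.2).resolve_left hκ0.ne'⟩

end Positivity

/-! ### Integrability of the Fourier transform and the approximating measures -/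

section Construction

variable {V : Type*} [NormedAddCommGroup V] [InnerProductSpace ℝ V] [FiniteDimensional ℝ V]
  [MeasurableSpace V] [BorelSpace V]

/-- The Gaussian-damped function `F_σ = exp (-σ‖·‖²/2) · C` is integrable when `‖C‖ ≤ 1`.
[folklore] -/
theorem integrable_gaussMul {C : V → ℂ} (hCc : Continuous C) (hCb : ∀ x, ‖C x‖ ≤ 1) {σ : ℝ}
    (hσ : 0 < σ) : Integrable (fun v : V => (rexp (-(σ / 2) * ‖v‖ ^ 2) : ℂ) * C v) := by
  refine (integrable_rexp_neg_mul_sq_norm (V := V) (half_pos hσ)).mono'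
    (by fun_prop : Continuous fun v : V => (rexp (-(σ / 2) * ‖v‖ ^ 2) : ℂ) * C v).aestronglyMeasurable
    (ae_of_all _ fun v => ?_)
  rw [norm_mul, Complex.norm_real, Real.norm_eq_abs, abs_of_pos (Real.exp_pos _)]
  exact mul_le_of_le_one_right (Real.exp_pos _).le (hCb v)

/-- The Fourier transform of the Gaussian `exp (-c⁻¹‖·‖²)` (an explicit Gaussian, Mathlib
`fourier_gaussian_innerProductSpace`) is integrable. [folklore] -/
theorem integrable_fourier_gaussian {c : ℝ} (hc : 0 < c) :
    Integrable (𝓕 (fun w : V => cexp (-(c⁻¹ : ℂ) * ‖w‖ ^ 2))) := by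
  have hb : 0 < ((c⁻¹ : ℝ) : ℂ).re := by simpa using hc
  have h : 𝓕 (fun w : V => cexp (-(c⁻¹ : ℂ) * ‖w‖ ^ 2)) = fun v : V =>
      (π / ((c⁻¹ : ℝ) : ℂ)) ^ (Module.finrank ℝ V / 2 : ℂ) *
        cexp (-π ^ 2 * ‖v‖ ^ 2 / ((c⁻¹ : ℝ) : ℂ)) := by
    funext v
    have := fourier_gaussian_innerProductSpace hb v
    push_cast at this ⊢
    exact this
  rw [h]
  have hb2 : 0 < (((π ^ 2 * c : ℝ) : ℂ)).re := by
    simp only [Complex.ofReal_re]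
    positivity
  have h2 : Integrable (fun v : V => cexp (-((π ^ 2 * c : ℝ) : ℂ) * ‖v‖ ^ 2)) :=
    (GaussianFourier.integrable_cexp_neg_mul_sq_norm_add hb2 0 (0 : V)).congr
      (ae_of_all _ fun v => by simp)
  refine (h2.const_mul ((π / ((c⁻¹ : ℝ) : ℂ)) ^ (Module.finrank ℝ V / 2 : ℂ))).congr
    (ae_of_all _ fun v => ?_)
  dsimp only
  congr 2
  push_cast
  field_simp

/-- The total mass of the heat kernel: `∫ ‖𝓕 (exp (-c⁻¹‖·‖²)) (v)‖ dv = 1`. [folklore] -/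
theorem integral_norm_fourier_gaussian {c : ℝ} (hc : 0 < c) :
    ∫ v : V, ‖𝓕 (fun w : V => cexp (-(c⁻¹ : ℂ) * ‖w‖ ^ 2)) v‖ = 1 := by
  have hb : 0 < ((c⁻¹ : ℝ) : ℂ).re := by simpa using hc
  have hpt : ∀ v : V, ‖𝓕 (fun w : V => cexp (-(c⁻¹ : ℂ) * ‖w‖ ^ 2)) v‖ =
      (π * c) ^ (Module.finrank ℝ V / 2 : ℝ) * rexp (-(π ^ 2 * c) * ‖v‖ ^ 2) := by
    intro v
    have h1 := fourier_gaussian_innerProductSpace hb v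
    push_cast at h1
    rw [h1, norm_mul, Complex.norm_exp]
    congr 1
    · rw [← Complex.ofReal_inv, ← Complex.ofReal_div,
        show ((Module.finrank ℝ V : ℂ) / 2) = (((Module.finrank ℝ V : ℝ) / 2 : ℝ) : ℂ) by push_cast; ring,
        Complex.norm_cpow_eq_rpow_re_of_pos (by positivity), Complex.ofReal_re, div_inv_eq_mul]
    · congr 1
      rw [← Complex.ofReal_inv]
      have : (-(π : ℂ) ^ 2 * (‖v‖ : ℂ) ^ 2 / ((c⁻¹ : ℝ) : ℂ)) = ((-(π ^ 2 * c) * ‖v‖ ^ 2 : ℝ) : ℂ) := by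
        push_cast
        field_simp
      rw [this, Complex.ofReal_re]
  simp_rw [hpt]
  rw [integral_const_mul, GaussianFourier.integral_rexp_neg_mul_sq_norm (by positivity),
    ← Real.mul_rpow (by positivity) (by positivity)]
  have : π * c * (π / (π ^ 2 * c)) = 1 := by
    field_simp
  rw [this, Real.one_rpow]

/-- **The Fourier transform of `F_σ` is integrable** (with `∫ Re 𝓕F_σ ≤ 1`): it is a nonnegative
real function (`re_fourier_gauss_mul_nonneg`), and testing against the Gaussians
`exp (-c⁻¹‖w‖²) ↑ 1` with the self-adjointness of the Fourier transform gives
`∫ exp (-c⁻¹‖w‖²) 𝓕F_σ(w) dw = ∫ F_σ · 𝓕(Gaussian) ≤ 1`, whence the claim by monotone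
convergence. Bochner 1933, §3 (proof of Satz 22). [cite: Bochner1933, §3] -/
theorem IsPositiveDefinite.integrable_fourier_gaussMul {C : V → ℂ} (hC : IsPositiveDefinite C)
    (hCc : Continuous C) (hCb : ∀ x, ‖C x‖ ≤ 1) {σ : ℝ} (hσ : 0 < σ) :
    Integrable (𝓕 (fun v : V => (rexp (-(σ / 2) * ‖v‖ ^ 2) : ℂ) * C v)) ∧
      ∫⁻ w, ENNReal.ofReal (𝓕 (fun v : V => (rexp (-(σ / 2) * ‖v‖ ^ 2) : ℂ) * C v) w).re ≤ 1 := by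
  obtain ⟨F, hF⟩ : ∃ F : V → ℂ, F = fun v : V => (rexp (-(σ / 2) * ‖v‖ ^ 2) : ℂ) * C v :=
    ⟨_, rfl⟩
  have hFi : Integrable F := hF ▸ integrable_gaussMul hCc hCb hσ
  have hFb : ∀ v, ‖F v‖ ≤ 1 := fun v => by
    rw [hF, norm_mul, Complex.norm_real, Real.norm_eq_abs, abs_of_pos (Real.exp_pos _)]
    refine mul_le_one₀ ?_ (norm_nonneg _) (hCb v)
    rw [Real.exp_le_one_iff]
    nlinarith [sq_nonneg ‖v‖]
  rw [← hF]
  set q : V → ℂ := 𝓕 F with hq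
  have hqc : Continuous q :=
    VectorFourier.fourierIntegral_continuous Real.continuous_fourierChar
      (by exact continuous_inner) hFi
  have hq_re : ∀ w, 0 ≤ (q w).re := fun w => by
    have := (hC.re_fourier_gauss_mul_nonneg hCc hCb hσ w).1
    rwa [← hF] at this
  have hq_im : ∀ w, (q w).im = 0 := fun w => by
    have := (hC.re_fourier_gauss_mul_nonneg hCc hCb hσ w).2
    rwa [← hF] at this
  have hq_eq : ∀ w, q w = ((q w).re : ℂ) := fun w =>
    Complex.ext (by simp) (by simp [hq_im w])
  have hq_bd : ∀ w, ‖q w‖ ≤ ∫ v, ‖F v‖ := fun w =>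
    VectorFourier.norm_fourierIntegral_le_integral_norm _ _ _ _ _
  -- Gaussian test functions
  have hbound : ∀ c : ℝ, 0 < c → ∫ w, rexp (-c⁻¹ * ‖w‖ ^ 2) * (q w).re ≤ 1 := by
    intro c hc
    have hb : 0 < ((c⁻¹ : ℝ) : ℂ).re := by simpa using hc
    have J : Integrable (fun w : V => cexp (-(c⁻¹ : ℂ) * ‖w‖ ^ 2)) := by
      have := GaussianFourier.integrable_cexp_neg_mul_sq_norm_add hb 0 (0 : V)
      refine this.congr (ae_of_all _ fun w => ?_)
      simp
    have key : ∫ w, 𝓕 (fun w : V => cexp (-(c⁻¹ : ℂ) * ‖w‖ ^ 2)) w • F w =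
        ∫ w, cexp (-(c⁻¹ : ℂ) * ‖w‖ ^ 2) • q w := by
      simpa using! (VectorFourier.integral_fourierIntegral_smul_eq_flip (L := innerₗ V)
        Real.continuous_fourierChar continuous_inner J hFi)
    have hreal : ∫ w, cexp (-(c⁻¹ : ℂ) * ‖w‖ ^ 2) • q w =
        ((∫ w, rexp (-c⁻¹ * ‖w‖ ^ 2) * (q w).re : ℝ) : ℂ) := by
      rw [← integral_complex_ofReal]
      refine integral_congr_ae (ae_of_all _ fun w => ?_)
      dsimp only
      rw [smul_eq_mul, hq_eq w]
      push_cast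
      simp
    have hnorm : ‖∫ w, 𝓕 (fun w : V => cexp (-(c⁻¹ : ℂ) * ‖w‖ ^ 2)) w • F w‖ ≤ 1 := by
      rw [← integral_norm_fourier_gaussian (V := V) hc]
      refine norm_integral_le_of_norm_le (integrable_fourier_gaussian hc).norm
        (ae_of_all _ fun w => ?_)
      rw [norm_smul]
      exact mul_le_of_le_one_right (norm_nonneg _) (hFb w)
    calc ∫ w, rexp (-c⁻¹ * ‖w‖ ^ 2) * (q w).re
        = (∫ w, cexp (-(c⁻¹ : ℂ) * ‖w‖ ^ 2) • q w).re := by rw [hreal, Complex.ofReal_re]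
      _ ≤ ‖∫ w, cexp (-(c⁻¹ : ℂ) * ‖w‖ ^ 2) • q w‖ := Complex.re_le_norm _
      _ ≤ 1 := by rw [← key]; exact hnorm
  -- monotone convergence
  have hlin : ∫⁻ w, ENNReal.ofReal (q w).re ≤ 1 := by
    set g : ℕ → V → ℝ := fun n w => rexp (-((n : ℝ) + 1)⁻¹ * ‖w‖ ^ 2) with hg
    have hg1 : ∀ n w, g n w ≤ 1 := fun n w => by
      simp only [hg, Real.exp_le_one_iff]
      nlinarith [sq_nonneg ‖w‖, inv_pos.2 (by positivity : (0 : ℝ) < n + 1)]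
    have hgmono : ∀ w, Monotone fun n => g n w := by
      intro w m n hmn
      simp only [hg]
      gcongr
    have hgt : ∀ w, Tendsto (fun n => g n w) atTop (𝓝 1) := by
      intro w
      show Tendsto (fun n : ℕ => rexp (-((n : ℝ) + 1)⁻¹ * ‖w‖ ^ 2)) atTop (𝓝 1)
      have h1 : Tendsto (fun n : ℕ => ((n : ℝ) + 1)⁻¹) atTop (𝓝 0) := by
        simpa only [one_div] using tendsto_one_div_add_atTop_nhds_zero_nat (𝕜 := ℝ)
      have h2 : Tendsto (fun n : ℕ => rexp (-((n : ℝ) + 1)⁻¹ * ‖w‖ ^ 2)) atTop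
          (𝓝 (rexp (-0 * ‖w‖ ^ 2))) :=
        (Real.continuous_exp.tendsto _).comp (h1.neg.mul_const (‖w‖ ^ 2))
      simpa using h2
    have hmeas : ∀ n, AEMeasurable (fun w => ENNReal.ofReal (g n w * (q w).re)) volume := fun n =>
      (ENNReal.measurable_ofReal.comp ((by fun_prop : Continuous fun w => g n w * (q w).re).measurable)).aemeasurable
    have hlim := lintegral_tendsto_of_tendsto_of_monotone (μ := volume) hmeas
      (ae_of_all _ fun w m n hmn => ENNReal.ofReal_le_ofReal
        (mul_le_mul_of_nonneg_right (hgmono w hmn) (hq_re w)))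
      (ae_of_all _ fun w => by
        have := ((hgt w).mul_const ((q w).re))
        rw [one_mul] at this
        exact (ENNReal.continuous_ofReal.tendsto _).comp this)
    refine le_of_tendsto' hlim fun n => ?_
    have hint : Integrable (fun w => g n w * (q w).re) := by
      refine ((integrable_rexp_neg_mul_sq_norm (V := V) (by positivity :
        (0 : ℝ) < ((n : ℝ) + 1)⁻¹)).mul_const (∫ v, ‖F v‖)).mono'
        (by fun_prop : Continuous fun w => g n w * (q w).re).aestronglyMeasurable
        (ae_of_all _ fun w => ?_)
      rw [Real.norm_eq_abs, abs_mul, abs_of_pos (Real.exp_pos _), abs_of_nonneg (hq_re w)]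
      exact mul_le_mul_of_nonneg_left ((Complex.re_le_norm _).trans (hq_bd w)) (Real.exp_pos _).le
    rw [← ofReal_integral_eq_lintegral_ofReal hint
      (ae_of_all _ fun w => mul_nonneg (Real.exp_pos _).le (hq_re w)), ← ENNReal.ofReal_one]
    exact ENNReal.ofReal_le_ofReal (hbound _ (by positivity))
  refine ⟨?_, hlin⟩
  have hre_int : Integrable (fun w => (q w).re) := by
    refine ⟨(Complex.continuous_re.comp hqc).aestronglyMeasurable, ?_⟩
    rw [hasFiniteIntegral_iff_enorm]
    calc ∫⁻ w, ‖(q w).re‖ₑ = ∫⁻ w, ENNReal.ofReal (q w).re :=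
          lintegral_congr fun w => Real.enorm_eq_ofReal (hq_re w)
      _ ≤ 1 := hlin
      _ < ⊤ := ENNReal.one_lt_top
  have h := hre_int.ofReal (𝕜 := ℂ)
  exact h.congr (ae_of_all _ fun w => (hq_eq w).symm)

/-- **The approximating measures.** For `C` continuous positive definite with `C 0 = 1` and
`σ > 0` there is a probability measure `μ_σ` with characteristic function
`exp (-σ‖t‖²/2) C(t)`: the measure with density `𝓕 F_σ ≥ 0` (rescaled by `2π` to pass from
Mathlib's Fourier conventions to `charFun`), by the Fourier inversion theorem (Mathlib
`Continuous.fourierInv_fourier_eq`); it has mass `F_σ(0) = 1`. Bochner 1933, §3, proof of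
Satz 22. [cite: Bochner1933, §3] -/
theorem IsPositiveDefinite.exists_measure_charFun_gaussMul {C : V → ℂ}
    (hC : IsPositiveDefinite C) (hCc : Continuous C) (hCb : ∀ x, ‖C x‖ ≤ 1) (h0 : C 0 = 1)
    {σ : ℝ} (hσ : 0 < σ) :
    ∃ μ : Measure V, IsProbabilityMeasure μ ∧
      ∀ t, charFun μ t = (rexp (-(σ / 2) * ‖t‖ ^ 2) : ℂ) * C t := by
  obtain ⟨F, hF⟩ : ∃ F : V → ℂ, F = fun v : V => (rexp (-(σ / 2) * ‖v‖ ^ 2) : ℂ) * C v :=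
    ⟨_, rfl⟩
  have hFi : Integrable F := hF ▸ integrable_gaussMul hCc hCb hσ
  have hFc : Continuous F := by
    rw [hF]
    fun_prop
  obtain ⟨hqi, -⟩ := hC.integrable_fourier_gaussMul hCc hCb hσ
  rw [← hF] at hqi
  set q : V → ℂ := 𝓕 F with hq
  have hqc : Continuous q :=
    VectorFourier.fourierIntegral_continuous Real.continuous_fourierChar
      (by exact continuous_inner) hFi
  have hq_re : ∀ w, 0 ≤ (q w).re := fun w => by
    have := (hC.re_fourier_gauss_mul_nonneg hCc hCb hσ w).1
    rwa [← hF] at this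
  have hq_im : ∀ w, (q w).im = 0 := fun w => by
    have := (hC.re_fourier_gauss_mul_nonneg hCc hCb hσ w).2
    rwa [← hF] at this
  have hq_eq : ∀ w, q w = ((q w).re : ℂ) := fun w =>
    Complex.ext (by simp) (by simp [hq_im w])
  have hinv : 𝓕⁻ q = F := hFc.fourierInv_fourier_eq hFi hqi
  -- the density measure and its rescaling
  set d : V → ℝ≥0 := fun w => ((q w).re).toNNReal with hd
  have hdm : Measurable d := (Complex.continuous_re.comp hqc).measurable.real_toNNReal
  set ν : Measure V := volume.withDensity (fun w => (d w : ℝ≥0∞)) with hν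
  haveI : IsFiniteMeasure ν := by
    refine isFiniteMeasure_withDensity (ne_of_lt (lt_of_le_of_lt (lintegral_mono fun w => ?_)
      hqi.hasFiniteIntegral))
    change ENNReal.ofReal (q w).re ≤ ‖q w‖ₑ
    rw [← ofReal_norm]
    exact ENNReal.ofReal_le_ofReal (Complex.re_le_norm _)
  set μ : Measure V := ν.map (fun w => (2 * π) • w) with hμ
  have hμint : ∀ g : V → ℂ, Continuous g → ∫ x, g x ∂μ = ∫ w, q w * g ((2 * π) • w) := by
    intro g hg
    rw [hμ, integral_map (by fun_prop : AEMeasurable (fun w : V => (2 * π) • w) ν)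
      hg.aestronglyMeasurable, hν, integral_withDensity_eq_integral_smul hdm]
    refine integral_congr_ae (ae_of_all _ fun w => ?_)
    simp only [hd]
    rw [NNReal.smul_def, Real.coe_toNNReal _ (hq_re w), Complex.real_smul, ← hq_eq w]
  have hchar : ∀ t, charFun μ t = F t := by
    intro t
    rw [charFun_apply, hμint _ (by fun_prop), ← hinv, Real.fourierInv_eq']
    refine integral_congr_ae (ae_of_all _ fun w => ?_)
    dsimp only
    rw [real_inner_smul_left, smul_eq_mul, mul_comm (q w)]
  have hμ1 : μ Set.univ = 1 := by
    have h1 : charFun μ 0 = 1 := by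
      rw [hchar, hF]
      simp [h0]
    rw [charFun_zero] at h1
    exact (ENNReal.toReal_eq_one_iff _).1 (by exact_mod_cast h1)
  refine ⟨μ, ⟨hμ1⟩, fun t => ?_⟩
  rw [hchar, hF]

end Construction

/-! ### Bochner's theorem -/

section Bochner

variable {V : Type*} [NormedAddCommGroup V] [InnerProductSpace ℝ V] [MeasurableSpace V]
  [BorelSpace V]

/-- **Bochner's theorem, existence half** (discharge of the named fact
`Literature.Analysis.FunctionSpaces.IsPositiveDefinite.exists_charFun_eq`): on a finite-dimensional real inner product space, a
continuous positive-definite `C` with `C 0 = 1` is the characteristic function of a probability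
measure. Proof: the probability measures `μₙ` with `charFun μₙ (t) = exp (-‖t‖²/(2(n+1))) C(t)`
(`exists_measure_charFun_gaussMul`) have characteristic functions converging pointwise to the
continuous `C`, hence form a tight family (Mathlib `isTightMeasureSet_of_tendsto_charFun`,
Lévy); by Prokhorov's theorem (Mathlib `isCompact_closure_of_isTightMeasureSet`) a subsequence
converges weakly, and the limit has characteristic function `C` (Mathlib
`ProbabilityMeasure.tendsto_iff_tendsto_charFun`). Bochner, Math. Ann. 108 (1933), Satz 22
(for `ℝ`); Bochner–Chandrasekharan, *Fourier transforms* (1949) for `ℝⁿ`.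
[cite: Bochner1933, Satz 22] [cite: BochnerChandrasekharan1949] -/
theorem IsPositiveDefinite.exists_charFun_eq_holds :
    IsPositiveDefinite.exists_charFun_eq (E := V) := by
  intro _ C hp hc h0
  have hCb : ∀ x, ‖C x‖ ≤ 1 := fun x => by
    have := IsPositiveDefinite.norm_apply_le_holds hp x
    rwa [h0, Complex.one_re] at this
  choose μ hμP hμC using fun n : ℕ =>
    hp.exists_measure_charFun_gaussMul hc hCb h0 (σ := 1 / ((n : ℝ) + 1)) (by positivity)
  set μP : ℕ → ProbabilityMeasure V := fun n => ⟨μ n, hμP n⟩ with hμP_def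
  have hlim : ∀ t, Tendsto (fun n => charFun (μP n : Measure V) t) atTop (𝓝 (C t)) := by
    intro t
    have hg : Continuous fun x : ℝ => (rexp (-(x / 2) * ‖t‖ ^ 2) : ℂ) * C t := by fun_prop
    have h1 := (hg.tendsto 0).comp (tendsto_one_div_add_atTop_nhds_zero_nat (𝕜 := ℝ))
    simp only [zero_div, neg_zero, zero_mul, Real.exp_zero, Complex.ofReal_one, one_mul] at h1
    refine h1.congr fun n => ?_
    simp only [Function.comp_apply, hμP_def]
    exact (hμC n t).symm
  have htight : IsTightMeasureSet (Set.range fun n => (μP n : Measure V)) :=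
    isTightMeasureSet_of_tendsto_charFun (μ := fun n => (μP n : Measure V)) hc.continuousAt hlim
  have hcomp : IsCompact (closure (Set.range μP)) := by
    refine isCompact_closure_of_isTightMeasureSet ?_
    convert htight using 1
    ext ν
    simp
  obtain ⟨ν, -, φ, hφ, hconv⟩ :=
    hcomp.tendsto_subseq (fun n => subset_closure (Set.mem_range_self n))
  refine ⟨ν, inferInstance, funext fun t => ?_⟩
  have h1 := (ProbabilityMeasure.tendsto_iff_tendsto_charFun.1 hconv) t
  have h2 : Tendsto (fun n => charFun (μP (φ n) : Measure V) t) atTop (𝓝 (C t)) :=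
    (hlim t).comp hφ.tendsto_atTop
  exact tendsto_nhds_unique h1 h2

/-- **Bochner's theorem** (discharge of the named fact `Literature.Analysis.FunctionSpaces.bochner`): existence by
`exists_charFun_eq_holds`, uniqueness by Mathlib's `Measure.ext_of_charFun` (Lévy).
[cite: Bochner1933, Satz 22] -/
theorem bochner_holds : bochner (E := V) := by
  intro _ C hc hp h0
  obtain ⟨μ, hμ, hμC⟩ := IsPositiveDefinite.exists_charFun_eq_holds hp hc h0
  haveI : CompleteSpace V := FiniteDimensional.complete ℝ V
  refine ⟨μ, ⟨hμ, hμC⟩, fun ν ⟨hν, hνC⟩ => ?_⟩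
  exact Measure.ext_of_charFun (hνC.trans hμC.symm)

end Bochner

end Literature.Analysis.FunctionSpaces
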